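import Mathlib.RingTheory.AdjoinRoot
import Mathlib.Algebra.Polynomial.Bivariate
import Mathlib.RingTheory.DedekindDomain.Dvr
import Mathlib.RingTheory.DiscreteValuationRing.TFAE
import Mathlib.RingTheory.Ideal.GoingUp
import Mathlib.RingTheory.Polynomial.UniqueFactorization
import Mathlib.Algebra.Squarefree.Basic
import HarnessLib

/-!
# The affine coordinate ring `K[X, Y]/(Y² − f(X))` of a double cover of the line is a Dedekind domain

Let `K` be a field with `2 ∈ Kˣ` and `f ∈ K[X]` SQUAREFREE of positive degree. The affine plane curve
`C_f : y² = f(x)` (hyperelliptic for `deg f ≥ 5`) is smooth, and its coordinate ring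
`K[C_f] = K[X][Y]/(Y² − f)` — here `CoordRing f := AdjoinRoot (poly f)`, `poly f := Y² − C f`, mirroring
Mathlib's `WeierstrassCurve.Affine.polynomial` / `CoordinateRing` — is a Dedekind domain (`isDedekindDomain`).
More precisely, for every maximal ideal `𝔪` with `𝔪 ∩ K[X] = (p)` the local ring `K[C_f]_𝔪` is a DVR whose
maximal ideal is generated by `p(x)` if `y ∉ 𝔪` (`map_eq_span_algebraMap_gen_of_y_not_mem`) and by `y` if
`y ∈ 𝔪`, in which case `p ∣ f`, `p² ∤ f` (`map_eq_span_y_of_y_mem`): the ring-theoretic form of the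
ramification picture of `K(x, y)/K(x)`, `y² = f(x)`, `f` squarefree, `char K ≠ 2` — ramified exactly over
the zeros of `f` (and possibly `∞`), `y` a local parameter there, unramified elsewhere
[cite: Stichtenoth2009, Prop 6.2.3 (c)] (Stichtenoth, *Algebraic Function Fields and Codes*, GTM 254,
Prop. 6.2.3 (c) via Prop. 3.7.3; cf. Liu, *Algebraic Geometry and Arithmetic Curves*, §7.4.3). The proof
pattern is that of the tree's `Literature.NumberTheory.EllipticCurves.CoordinateRingRegular` (Weierstrass
cubics, Silverman AEC Prop. II.1.1): an explicit local parameter at every closed point, then Mathlib's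
`IsDiscreteValuationRing.TFAE` and `IsDedekindDomainDvr`.

Proof. Every element of `R = K[C_f]` is `a(x) + b(x)·y`. If `y ≡ s(x) (mod 𝔪)` then
`𝔪 = (p(x), y − s(x))` and `(y − s)·((y − s) + 2s) = −(s² − f) = −p·u` in `R`. If `2s(x) ∉ 𝔪` then
`(y − s) + 2s` is a unit of `R_𝔪` and `𝔪R_𝔪 = (p)`. If `2s(x) ∈ 𝔪` then `p ∣ s` (as `2 ∈ Kˣ`), and
`u(x) ∉ 𝔪` — otherwise `p² ∣ s²` and `p² ∣ s² − f` give `p² ∣ f`, contradicting squarefreeness — so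
`𝔪R_𝔪 = (y − s)`. If no such `s` exists, `𝔪 = p·R` is already principal. A Noetherian local domain, not a
field, with principal maximal ideal is a DVR, and `IsDedekindDomainDvr` concludes.

Written as a generic brick (the abc-iut cell's classical support item `GenEllTwo` uses the curve
`s² = 1 − 4r^e`); nothing here refers to that application. No instances are declared — the results are
theorems, invoked with `haveI` (`isDomain`, `moduleFinite`, `dimensionLEOne`). Not here: the point(s) at
infinity, the projective closure, the genus.
-/

noncomputable section

open Polynomial
open scoped Polynomial.Bivariate

namespace Literature.NumberTheory.DiophantineGeometry.HyperellipticCoordinateRing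

universe u

section CommRing

variable {K : Type u} [CommRing K] (f : K[X])

/-- The polynomial `Y² − f(X) ∈ K[X][Y]` cutting out the double cover `y² = f(x)` of the affine line
(analogue of Mathlib's `WeierstrassCurve.Affine.polynomial`). [cite: Stichtenoth2009, Prop 6.2.3] -/
def poly : K[X][Y] := Y ^ 2 - C f

/-- The affine coordinate ring `K[C_f] = K[X][Y]/(Y² − f(X))` of the double cover `y² = f(x)`
(the analogue of Mathlib's `WeierstrassCurve.Affine.CoordinateRing`). [cite: Stichtenoth2009, Prop 6.2.3] -/
abbrev CoordRing : Type u := AdjoinRoot (poly f)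

/-- `Y² − f(X)` is monic in `Y`. [cite: Stichtenoth2009, Prop 6.2.3] -/
theorem monic_poly : (poly f).Monic := monic_X_pow_sub_C f two_ne_zero

/-- `Y² − f(X)` has degree `2` in `Y`. [cite: Stichtenoth2009, Prop 6.2.3] -/
theorem natDegree_poly [Nontrivial K] : (poly f).natDegree = 2 := natDegree_X_pow_sub_C

/-- `Y² − f(X)` has degree `2` in `Y` (`WithBot` form). [cite: Stichtenoth2009, Prop 6.2.3] -/
theorem degree_poly [Nontrivial K] : (poly f).degree = 2 := degree_X_pow_sub_C two_pos f

/-- `K[C_f]` is a finite `K[X]`-module (free on `1, y`). [cite: Stichtenoth2009, Prop 6.2.3] -/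
theorem moduleFinite : Module.Finite K[X] (CoordRing f) := (monic_poly f).finite_adjoinRoot

/-- Every element of `K[C_f]` is `a(x) + b(x)·y` with `a, b ∈ K[X]` (reduction modulo the monic
polynomial `Y² − f`). [cite: Stichtenoth2009, Prop 6.2.3] -/
theorem exists_eq_add_mul_y [Nontrivial K] (r : CoordRing f) :
    ∃ a b : K[X], r = algebraMap K[X] _ a + algebraMap K[X] _ b * AdjoinRoot.root (poly f) := by
  obtain ⟨q, rfl⟩ := AdjoinRoot.mk_surjective r
  set g : K[X][Y] := poly f with hg
  have hmod : AdjoinRoot.mk g q = AdjoinRoot.mk g (q %ₘ g) :=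
    AdjoinRoot.mk_eq_mk.mpr ⟨q /ₘ g, by linear_combination -modByMonic_add_div q g⟩
  have hdeg : (q %ₘ g).degree ≤ 1 := by
    have h := degree_modByMonic_lt q (monic_poly f)
    rw [← hg, degree_poly] at h
    have : (q %ₘ g).degree < (2 : ℕ) := by exact_mod_cast h
    exact Order.le_of_lt_succ (by exact_mod_cast this)
  refine ⟨(q %ₘ g).coeff 0, (q %ₘ g).coeff 1, ?_⟩
  rw [hmod]
  conv_lhs => rw [eq_X_add_C_of_degree_le_one hdeg]
  rw [map_add, map_mul, AdjoinRoot.mk_C, AdjoinRoot.mk_C, AdjoinRoot.mk_X, AdjoinRoot.algebraMap_eq]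
  ring

end CommRing

variable {K : Type u} [Field K] {f : K[X]}

/- Local notation: `HR = K[C_f]`, the structure map `cR : K[X] → K[C_f]`, and `yR = y`. -/
local notation "HR" => CoordRing f
local notation "cR" => algebraMap K[X] (CoordRing f)
local notation "yR" => AdjoinRoot.root (poly f)

/-- **`Y² − f` is irreducible** in `K[X][Y]` when `f` is squarefree of positive degree: a factorisation
of the monic quadratic would give `g ∈ K[X]` with `g² = f` (compare coefficients), and then `g ∣ f` twice
forces `g`, hence `f`, to be a unit. [cite: Stichtenoth2009, Prop 6.2.3] -/
theorem irreducible_poly (hf : Squarefree f) (hf0 : 0 < f.natDegree) : Irreducible (poly f) := by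
  by_contra h
  obtain ⟨c₁, c₂, h0, h1⟩ :=
    ((monic_poly f).not_irreducible_iff_exists_add_mul_eq_coeff (natDegree_poly f)).mp h
  have hc0 : (poly f).coeff 0 = -f := by simp [poly, coeff_C, coeff_X_pow]
  have hc1 : (poly f).coeff 1 = 0 := by simp [poly, coeff_X_pow]
  rw [hc0] at h0
  rw [hc1] at h1
  -- `c₂ = -c₁`, so `f = c₁²`, and `c₁ ∣ f` twice makes `f` a unit
  have hsq : f = c₁ * c₁ := by linear_combination -h0 + c₁ * h1
  have hunit : IsUnit c₁ := hf c₁ ⟨1, by rw [mul_one]; exact hsq⟩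
  have := natDegree_eq_zero_of_isUnit (hsq ▸ hunit.mul hunit)
  omega

/-- `K[C_f]` is an integral domain (`f` squarefree of positive degree): `Y² − f` is irreducible, hence
prime in the factorial ring `K[X][Y]`. [cite: Stichtenoth2009, Prop 6.2.3] -/
theorem isDomain (hf : Squarefree f) (hf0 : 0 < f.natDegree) : IsDomain HR :=
  AdjoinRoot.isDomain_of_prime (irreducible_poly hf hf0).prime

/-- `K[C_f]` has Krull dimension `≤ 1`: it is integral over the principal ideal domain `K[X]`
(Mathlib `Ring.DimensionLEOne.of_isIntegral`). [cite: Stichtenoth2009, Prop 6.2.3] -/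
theorem dimensionLEOne (hf : Squarefree f) (hf0 : 0 < f.natDegree) : Ring.DimensionLEOne HR := by
  haveI := isDomain hf hf0
  haveI := moduleFinite f
  exact Ring.DimensionLEOne.of_isIntegral K[X] _

/-- The structure map `K[X] → K[C_f]` is injective. [cite: Stichtenoth2009, Prop 6.2.3] -/
theorem algebraMap_injective (f : K[X]) : Function.Injective (algebraMap K[X] (CoordRing f)) := by
  rw [AdjoinRoot.algebraMap_eq]
  exact AdjoinRoot.of.injective_of_degree_ne_zero (by rw [degree_poly]; exact two_ne_zero)

/-- `K[C_f]` is not a field (it is an integral extension of `K[X]`, which is not a field). [cite: Stichtenoth2009, Prop 6.2.3] -/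
theorem not_isField (f : K[X]) : ¬ IsField (CoordRing f) := by
  haveI := moduleFinite f
  exact fun h ↦ Polynomial.not_isField K <|
    isField_of_isIntegral_of_isField (R := K[X]) (S := CoordRing f) (algebraMap_injective f) h

/-- A maximal ideal of `K[C_f]` is nonzero. [cite: Stichtenoth2009, Prop 6.2.3] -/
theorem ne_bot_of_isMaximal (hf : Squarefree f) (hf0 : 0 < f.natDegree) (m : Ideal HR)
    [hm : m.IsMaximal] : m ≠ ⊥ :=
  haveI := isDomain hf hf0
  Ring.ne_bot_of_isMaximal_of_not_isField hm (not_isField f)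

section MaximalIdeal

variable (m : Ideal (CoordRing f))

/-- The contraction `𝔪 ∩ K[X]` of an ideal of `K[C_f]`. [cite: Stichtenoth2009, Prop 6.2.3] -/
abbrev contraction : Ideal K[X] := m.comap (algebraMap K[X] HR)

/-- A generator `p` of the principal ideal `𝔪 ∩ K[X] = (p)` of `K[X]`. [cite: Stichtenoth2009, Prop 6.2.3] -/
def gen : K[X] := Submodule.IsPrincipal.generator (contraction m)

/-- `𝔪 ∩ K[X] = (p)`. [cite: Stichtenoth2009, Prop 6.2.3] -/
theorem span_gen : Ideal.span {gen m} = contraction m :=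
  Ideal.span_singleton_generator _

/-- `h(x) ∈ 𝔪 ↔ p ∣ h`. [cite: Stichtenoth2009, Prop 6.2.3] -/
theorem algebraMap_mem_iff (h : K[X]) : cR h ∈ m ↔ gen m ∣ h := by
  rw [← Ideal.mem_span_singleton, span_gen]; rfl

/-- `p(x) ∈ 𝔪`. [cite: Stichtenoth2009, Prop 6.2.3] -/
theorem algebraMap_gen_mem : cR (gen m) ∈ m := (algebraMap_mem_iff m _).2 dvd_rfl

/-- **Split closed points.** If `y ≡ s(x) (mod 𝔪)` for some `s ∈ K[X]`, then `𝔪 = (p(x), y − s(x))`: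
for `r = a(x) + b(x)y ∈ 𝔪`, `r = (a + bs)(x) + b(x)(y − s(x))` with `a + bs ∈ (p)`. [cite: Stichtenoth2009, Prop 6.2.3] -/
theorem eq_span_pair_of_mem {s : K[X]} (hs : yR - cR s ∈ m) :
    m = Ideal.span {cR (gen m), yR - cR s} := by
  refine le_antisymm (fun r hr ↦ ?_) ?_
  · obtain ⟨a, b, rfl⟩ := exists_eq_add_mul_y f r
    have hc : cR (a + b * s) ∈ m := by
      have : cR (a + b * s) = (cR a + cR b * yR) - cR b * (yR - cR s) := by
        simp only [map_add, map_mul]; ring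
      rw [this]
      exact m.sub_mem hr (m.mul_mem_left _ hs)
    obtain ⟨c, hc⟩ := (algebraMap_mem_iff m _).1 hc
    have : cR a + cR b * yR = cR c * cR (gen m) + cR b * (yR - cR s) := by
      have h1 : cR a = cR (gen m) * cR c - cR b * cR s := by
        rw [← map_mul, ← hc, map_add, map_mul]; ring
      rw [h1]; ring
    rw [this]
    exact Ideal.add_mem _ (Ideal.mul_mem_left _ _ (Ideal.subset_span (by simp)))
      (Ideal.mul_mem_left _ _ (Ideal.subset_span (by simp)))
  · rw [Ideal.span_le]
    rintro r (rfl | rfl)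
    · exact algebraMap_gen_mem m
    · exact hs

/-! ### The relation `y² = f(x)` and the Taylor identity at `Y = s(X)` -/

/-- `y² = f(x)` in `K[C_f]`. [cite: Stichtenoth2009, Prop 6.2.3] -/
theorem root_sq : yR ^ 2 = cR f := by
  have h : AdjoinRoot.mk (poly f) (Y ^ 2 - C f) = 0 := AdjoinRoot.mk_self
  rwa [map_sub, map_pow, AdjoinRoot.mk_X, AdjoinRoot.mk_C, sub_eq_zero, ← AdjoinRoot.algebraMap_eq] at h

/-- The Taylor identity in `K[C_f]`, factored: `(y − s(x))·((y − s(x)) + 2s(x)) = −(s² − f)(x)`. [cite: Stichtenoth2009, Prop 6.2.3] -/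
theorem sub_mul_add_eq (s : K[X]) :
    (yR - cR s) * (yR - cR s + cR (2 * s)) = -cR (s ^ 2 - f) := by
  have h2 : cR (2 * s) = 2 * cR s := by rw [map_mul, map_ofNat]
  rw [h2, map_sub, map_pow]
  linear_combination root_sq (f := f)

/-- If `y − s(x) ∈ 𝔪` then `(s² − f)(x) ∈ 𝔪`, i.e. `p ∣ s² − f`. [cite: Stichtenoth2009, Prop 6.2.3] -/
theorem gen_dvd_sq_sub {s : K[X]} (hs : yR - cR s ∈ m) : gen m ∣ s ^ 2 - f := by
  rw [← algebraMap_mem_iff]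
  rw [show cR (s ^ 2 - f) = -((yR - cR s) * ((yR - cR s) + cR (2 * s))) by
    rw [sub_mul_add_eq, neg_neg]]
  exact m.neg_mem (m.mul_mem_right _ hs)

/-- `2` is a unit of `K[X]` when it is a unit of `K`. [folklore] -/
private theorem isUnit_two_polynomial (h2 : IsUnit (2 : K)) : IsUnit (2 : K[X]) := by
  have h := h2.map (C : K →+* K[X])
  rwa [map_ofNat] at h

variable [hm : m.IsMaximal]

/-! ### Closed points: the squarefree step and the local rings -/

/-- `𝔪 ∩ K[X]` is maximal for `𝔪` maximal (`K[C_f]/K[X]` is integral). [cite: Stichtenoth2009, Prop 6.2.3] -/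
theorem contraction_isMaximal : (contraction m).IsMaximal := by
  haveI := moduleFinite f
  exact Ideal.isMaximal_comap_of_isIntegral_of_isMaximal m

/-- `p ≠ 0` (a maximal ideal of `K[X]` is nonzero). [cite: Stichtenoth2009, Prop 6.2.3] -/
theorem gen_ne_zero : gen m ≠ 0 := fun h ↦
  Ring.ne_bot_of_isMaximal_of_not_isField (contraction_isMaximal m) (Polynomial.not_isField K)
    (by rw [← span_gen, h, Ideal.span_singleton_zero])

/-- `p` is irreducible (it generates a nonzero maximal ideal of `K[X]`). [cite: Stichtenoth2009, Prop 6.2.3] -/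
theorem irreducible_gen : Irreducible (gen m) := by
  have hprime : Prime (gen m) := by
    rw [← Ideal.span_singleton_prime (gen_ne_zero m), span_gen]
    exact (contraction_isMaximal m).isPrime
  exact hprime.irreducible

/-- **Non-split closed points.** If the class of `y` in `K[C_f]/𝔪` is not in the image of `K[X]`, then
`𝔪 = p(x)·K[C_f]`: for `r = a(x) + b(x)y ∈ 𝔪`, if `p ∤ b` then `b(x)` is invertible mod `𝔪` (Bezout) and
`y ≡ −a(x)b(x)⁻¹`, a contradiction; so `p ∣ b`, then `p ∣ a`. [cite: Stichtenoth2009, Prop 6.2.3] -/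
theorem eq_span_singleton_of_forall_not_mem (hns : ∀ s : K[X], yR - cR s ∉ m) :
    m = Ideal.span {cR (gen m)} := by
  refine le_antisymm (fun r hr ↦ ?_) ?_
  · obtain ⟨a, b, rfl⟩ := exists_eq_add_mul_y f r
    have hb : gen m ∣ b := by
      by_contra hnd
      obtain ⟨c, d, hcd⟩ := (irreducible_gen m).coprime_iff_not_dvd.2 hnd
      -- `d(x) b(x) ≡ 1`, so `y ≡ -(a d)(x)`.
      apply hns (-(a * d))
      have key : yR - cR (-(a * d)) =
          cR d * (cR a + cR b * yR) + (1 - cR (c * gen m + d * b)) * yR + cR c * cR (gen m) * yR := by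
        simp only [map_add, map_mul, map_neg]; ring
      rw [key, hcd, map_one, sub_self, zero_mul, add_zero]
      exact m.add_mem (m.mul_mem_left _ hr)
        (m.mul_mem_right _ (m.mul_mem_left _ (algebraMap_gen_mem m)))
    obtain ⟨b', rfl⟩ := hb
    have ha : gen m ∣ a := by
      rw [← algebraMap_mem_iff]
      have : cR a = (cR a + cR (gen m * b') * yR) - cR b' * yR * cR (gen m) := by
        simp only [map_mul]; ring
      rw [this]
      exact m.sub_mem hr (m.mul_mem_left _ (algebraMap_gen_mem m))
    obtain ⟨a', rfl⟩ := ha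
    have : cR (gen m * a') + cR (gen m * b') * yR = (cR a' + cR b' * yR) * cR (gen m) := by
      simp only [map_mul]; ring
    rw [this]
    exact Ideal.mul_mem_left _ _ (Ideal.subset_span rfl)
  · rw [Ideal.span_le, Set.singleton_subset_iff]
    exact algebraMap_gen_mem m

/-- **The squarefree step** (smoothness of `C_f` at a closed point with `y ≡ s(x)`, `2s(x) ∈ 𝔪`): if
`2 ∈ Kˣ`, `f` is squarefree and `s² − f = p·u`, then `u(x) ∉ 𝔪` — otherwise `p ∣ u` and `p ∣ s` give
`p·p ∣ s² − (s² − f) = f` with `p` irreducible, contradicting `Squarefree f`. [cite: Stichtenoth2009, Prop 6.2.3 (c)] -/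
theorem not_mem_of_sq_sub_eq (h2 : IsUnit (2 : K)) (hf : Squarefree f) {s u : K[X]}
    (hv : cR (2 * s) ∈ m) (hu : s ^ 2 - f = gen m * u) : cR u ∉ m := by
  intro hum
  have hpu : gen m ∣ u := (algebraMap_mem_iff m u).1 hum
  have hps : gen m ∣ s :=
    ((isUnit_two_polynomial h2).dvd_mul_left).mp ((algebraMap_mem_iff m _).1 hv)
  have h1 : gen m * gen m ∣ s ^ 2 := by rw [sq]; exact mul_dvd_mul hps hps
  have h2' : gen m * gen m ∣ s ^ 2 - f := by rw [hu]; exact mul_dvd_mul_left _ hpu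
  exact (irreducible_gen m).not_isUnit (hf (gen m) (by simpa using dvd_sub h1 h2'))

/-! ### The local ring at `𝔪` is a discrete valuation ring -/

omit hm in
/-- If `a·b = −(c·d)` with `b` a unit then `a ∈ (c)`. [folklore] -/
private theorem mem_span_singleton_of_mul_eq {S : Type*} [CommRing S] {a b c d : S} (h : a * b = -(c * d))
    (hb : IsUnit b) : a ∈ Ideal.span {c} :=
  Ideal.mem_span_singleton'.mpr
    ⟨-(d * ↑hb.unit⁻¹), by linear_combination (-↑hb.unit⁻¹) * h + a * hb.mul_val_inv⟩

/-- **Uniformizer `p(x)` at the closed points with `y ∉ 𝔪`** (the points of `C_f` not on `y = 0`, where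
`C_f → 𝔸¹` is unramified): `𝔪R_𝔪 = (p(x))` for the generator `p` of `𝔪 ∩ K[X]` (`2 ∈ Kˣ`; no condition on
`f`). [cite: Stichtenoth2009, Prop 6.2.3 (c)] -/
theorem map_eq_span_algebraMap_gen_of_y_not_mem (h2 : IsUnit (2 : K)) (hy : yR ∉ m) :
    m.map (algebraMap HR (Localization.AtPrime m)) =
      Ideal.span {algebraMap HR (Localization.AtPrime m) (cR (gen m))} := by
  set Rm := Localization.AtPrime m
  set ι := algebraMap HR Rm
  have hunit : ∀ r : HR, r ∉ m → IsUnit (ι r) := fun r hr ↦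
    (IsLocalization.AtPrime.isUnit_to_map_iff Rm m r).2 hr
  by_cases hsplit : ∃ s : K[X], yR - cR s ∈ m
  · obtain ⟨s, hs⟩ := hsplit
    obtain ⟨u, hu⟩ := gen_dvd_sq_sub m hs
    have hR : (yR - cR s) * (yR - cR s + cR (2 * s)) = -(cR (gen m) * cR u) := by
      rw [sub_mul_add_eq, hu, map_mul]
    have hT' : ι (yR - cR s) * ι (yR - cR s + cR (2 * s)) = -(ι (cR (gen m)) * ι (cR u)) := by
      rw [← map_mul ι (yR - cR s), hR, map_neg ι, map_mul ι (cR (gen m))]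
    -- here `2 s(x) ∉ 𝔪`: otherwise `s(x) ∈ 𝔪` and `y = (y - s(x)) + s(x) ∈ 𝔪`
    have hv : cR (2 * s) ∉ m := by
      intro hv
      apply hy
      have h2u : IsUnit (cR 2) := (isUnit_two_polynomial h2).map _
      have hsm : cR s ∈ m := by
        rw [map_mul] at hv
        exact (Ideal.unit_mul_mem_iff_mem m h2u).mp hv
      simpa using m.add_mem hs hsm
    rw [congrArg (Ideal.map ι) (eq_span_pair_of_mem m hs), Ideal.map_span, Set.image_pair]
    have hw : yR - cR s + cR (2 * s) ∉ m := fun h ↦ hv (by simpa using m.sub_mem h hs)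
    rw [Ideal.span_insert, sup_eq_left, Ideal.span_singleton_le_iff_mem]
    exact mem_span_singleton_of_mul_eq hT' (hunit _ hw)
  · push Not at hsplit
    rw [congrArg (Ideal.map ι) (eq_span_singleton_of_forall_not_mem m hsplit), Ideal.map_span,
      Set.image_singleton]

/-- **Uniformizer `y` at the closed points on `y = 0`** (the ramification points of `C_f → 𝔸¹`, lying over
the zeros of `f`): if `y ∈ 𝔪` then `𝔪R_𝔪 = (y)`, and the generator `p` of `𝔪 ∩ K[X]` divides `f` but `p²`
does not (`2 ∈ Kˣ`, `f` squarefree). [cite: Stichtenoth2009, Prop 6.2.3 (c)] -/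
theorem map_eq_span_y_of_y_mem (h2 : IsUnit (2 : K)) (hf : Squarefree f) (hy : yR ∈ m) :
    m.map (algebraMap HR (Localization.AtPrime m)) =
        Ideal.span {algebraMap HR (Localization.AtPrime m) yR} ∧
      gen m ∣ f ∧ ¬ gen m * gen m ∣ f := by
  set Rm := Localization.AtPrime m
  set ι := algebraMap HR Rm
  have hunit : ∀ r : HR, r ∉ m → IsUnit (ι r) := fun r hr ↦
    (IsLocalization.AtPrime.isUnit_to_map_iff Rm m r).2 hr
  have h0 : yR - cR 0 = yR := by rw [map_zero, sub_zero]
  have hs : yR - cR 0 ∈ m := by rwa [h0]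
  obtain ⟨u, hu⟩ := gen_dvd_sq_sub m hs
  have hv : cR (2 * 0) ∈ m := by rw [mul_zero, map_zero]; exact m.zero_mem
  have huu := hunit _ (not_mem_of_sq_sub_eq m h2 hf hv hu)
  -- `y * y = -p u` in `R` (from `y² = f` and `0 - f = p u`)
  have hR : yR * yR = -(cR (gen m) * cR u) := by
    rw [← map_mul, ← hu, map_sub, map_pow, map_zero, ← sq, root_sq]; ring
  have hT' : ι yR * ι yR = -(ι (cR (gen m)) * ι (cR u)) := by
    rw [← map_mul ι yR, hR, map_neg ι, map_mul ι (cR (gen m))]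
  refine ⟨?_, ?_, fun hpp ↦ (irreducible_gen m).not_isUnit (hf (gen m) hpp)⟩
  · rw [congrArg (Ideal.map ι) (eq_span_pair_of_mem m hs), Ideal.map_span, Set.image_pair, h0,
      Ideal.span_insert, sup_eq_right, Ideal.span_singleton_le_iff_mem]
    exact mem_span_singleton_of_mul_eq (d := ι yR) (by linear_combination hT') huu
  · have : gen m ∣ (0 : K[X]) ^ 2 - f := gen_dvd_sq_sub m hs
    rwa [zero_pow two_ne_zero, zero_sub, dvd_neg] at this

/-- The maximal ideal `𝔪R_𝔪` of the local ring of `K[C_f]` at any maximal ideal `𝔪` is principal, generated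
by `y` if `y ∈ 𝔪` and by `p(x)` otherwise (`2 ∈ Kˣ`, `f` squarefree). [cite: Stichtenoth2009, Prop 6.2.3 (c)] -/
theorem exists_map_eq_span_singleton (h2 : IsUnit (2 : K)) (hf : Squarefree f) :
    ∃ ϖ ∈ m, m.map (algebraMap HR (Localization.AtPrime m)) =
      Ideal.span {algebraMap HR (Localization.AtPrime m) ϖ} := by
  rcases em (yR ∈ m) with hy | hy
  · exact ⟨yR, hy, (map_eq_span_y_of_y_mem m h2 hf hy).1⟩
  · exact ⟨cR (gen m), algebraMap_gen_mem m, map_eq_span_algebraMap_gen_of_y_not_mem m h2 hy⟩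

/-- **Regularity of the double cover `y² = f(x)` at every closed point.** For `f` squarefree of positive
degree over a field with `2 ∈ Kˣ`, the localization of `K[C_f] = K[X][Y]/(Y² − f)` at any maximal ideal
is a discrete valuation ring (Noetherian local domain, not a field, principal maximal ideal — Mathlib
`IsDiscreteValuationRing.TFAE`); the instance `[IsDomain (CoordRing f)]` is `isDomain hf hf0` via `haveI`.
[cite: Stichtenoth2009, Prop 6.2.3 (c)] -/
theorem isDiscreteValuationRing_localization [IsDomain (CoordRing f)] (h2 : IsUnit (2 : K))
    (hf : Squarefree f) (hf0 : 0 < f.natDegree) : IsDiscreteValuationRing (Localization.AtPrime m) := by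
  haveI : IsNoetherianRing (Localization.AtPrime m) :=
    IsLocalization.isNoetherianRing m.primeCompl _ inferInstance
  have hnf : ¬ IsField (Localization.AtPrime m) :=
    IsLocalization.AtPrime.not_isField HR (ne_bot_of_isMaximal hf hf0 m) _
  refine ((IsDiscreteValuationRing.TFAE (Localization.AtPrime m) hnf).out 0 4).mpr ?_
  obtain ⟨ϖ, -, hϖ⟩ := exists_map_eq_span_singleton m h2 hf
  rw [← Localization.AtPrime.map_eq_maximalIdeal, hϖ]
  exact ⟨⟨_, rfl⟩⟩

end MaximalIdeal

/-! ### `K[C_f]` is a Dedekind domain -/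

/-- **The coordinate ring of a double cover `y² = f(x)` of the affine line is a Dedekind domain**, for `f`
squarefree of positive degree over a field in which `2` is invertible: Noetherian, of dimension one, and
all its local rings at nonzero primes are discrete valuation rings (Mathlib `IsDedekindDomainDvr`), with
uniformizer `y` over the zeros of `f` and `p(x)` elsewhere. [cite: Stichtenoth2009, Prop 6.2.3 (c)] -/
theorem isDedekindDomain (h2 : IsUnit (2 : K)) (hf : Squarefree f) (hf0 : 0 < f.natDegree) :
    IsDedekindDomain HR := by
  haveI : IsDomain HR := isDomain hf hf0
  haveI : IsDedekindDomainDvr HR :=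
    { is_dvr_at_nonzero_prime := fun P hP hprime ↦ by
        haveI := dimensionLEOne hf hf0
        haveI : P.IsMaximal := hprime.isMaximal hP
        exact isDiscreteValuationRing_localization P h2 hf hf0 }
  exact IsDedekindDomainDvr.isDedekindDomain _

end Literature.NumberTheory.DiophantineGeometry.HyperellipticCoordinateRing
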